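import Summits.QuantumFields.YangMills.Theorems.BalabanUVNodesN17RunWindowShiftCornerDrift
import Summits.QuantumFields.YangMills.Theorems.BalabanUVNodesN17D1OfNamedLimit

/-!
# NODE N17 (NE4) — SUPPLIER ROAD TO K2⁷, FILE 7: GIVEN NODE N17, K2⁷ v7's REGISTERED (D1)-SIDE STUB 2ᶜᴰ `CornerDriftPos` («in-box corner limits `b` of the record's β drifting with SOME
# POSITIVE slope») IS EXACTLY «the corner limits exist and THEIR LIMIT IS POSITIVE» — drift and summability are node N17's; so MODULO NODE N17 + one-level (C), K2⁷ = ONE SIGN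

Cell `pub-ymgap`, YM-PLAN Track A (HUMAN RULINGS D-0062 ∕ D-0149), WIDTH SEAT `pub-ymgap-dag-n17-w1` (generation 4), third module.  Key K3⁷ stmt-QuantumFields-20544
(`--kind proof --supports 20544 --as helper`, COUNT-NEUTRAL); via node N17 also K2⁷ stmt-QuantumFields-20543 (v7 **795c9e8285fed415**, REGISTERED 2026-08-28T07:44:57Z: 2ᶜᴰ `stub_cornerDriftPos13 :
CornerDriftPos` — JOINT owners per plan g84 incl. this seat's INTENT-2 —, 1ᶜᴿ `stub_runChainCornerSlope13 : RunChain190AtCornerDriftSlope`).  Continues FILE 6 (p613927,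
`…N17RunWindowShiftCornerDrift`: crux BY NAME from {2ᶜᴰ, `N17AtRecord13`, one-level (C)}) and FILE 3 (p603839, `…N17D1OfNamedLimit`: drift ⟺ limit for geometrically convergent numbers).

THE POINT.  Given node N17 on the datum (box scale shift, `0 ≤ u.ρ < 1`, window `θ.γ`) and corner limits `b` (`ScaleAnchor D.βfun b`), FILE 1's `conv_of_scaleShiftRate_scaleAnchor` makes `b` converge
GEOMETRICALLY to some `L`; geometric convergence IS a drift with slope `L` (FILE 3's `oneLoopDrift_of_abs_sub_le_geometric`), and any drift slope of a convergent sequence IS its limit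
(`slope_eq_lim_of_oneLoopDrift`, Cesàro).  Hence (★★ `cornerDriftPos_iff_limPos_of_n17At_scaleAnchor`): GIVEN N17 + corner limits `b`,
  «`b` drifts with SOME POSITIVE slope» (2ᶜᴰ's conclusion at the tuple)  ⟺  «`b` tends to SOME POSITIVE limit»  ⟺  «`b` is eventually bounded below by a positive constant»
— the SUMMABILITY half of 2ᶜᴰ is node N17's, only the SIGN of ONE real number (the limit of the record's OWN corner numbers; κ-free, v₀-free, no named jets, no value `stepBal 2 F.L`) remains.
With FILE 6: (★★ `endpointExistence_of_n17At_scaleAnchor_limPos_survContAt`) N17 + corner limits with a positive limit + one-level (C) ⟹ `EndpointExistence D.C.toB12`.  Text level: ★★★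
`cornerDriftPos13_of_n17AtRecord13_cornerLimitPos13` — 2ᶜᴰ's REGISTERED text (conclusion VERBATIM) from the END-free `N17AtRecord13` text + (CLP13) «prefix → ∃ b L, ScaleAnchor D.βfun b ∧ b → L ∧ 0 < L»;
`cornerLimitPos13_of_cornerDriftPos13_n17AtRecord13` — the converse; ★★★ `EndpointGivenBR13SepCoPH_of_n17AtRecord13_cornerLimitPos13_surv13` — the crux decl BY NAME from {`N17AtRecord13`, (CLP13),
one-level (C)}.  LOCATED for the K2⁷ planners (count-neutral, no registry ask): MODULO NODE N17 (box keying) and survivor continuity at one level, K2⁷ v7 is «the record's β has in-box corner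
limits whose limit is POSITIVE» — existence (U3∕N18: `exists_scaleAnchor_of_histLipschitz`) + identification-free AF SIGN (β sub-cell ∕ CAP ∕ NODE O's sign half); the named-jets SIGN road
(d1-w1 g2 `…K2CornerDriftOfAnchorSign`: `0 < CauchyRate.lim (beta0OfJs F κ)` at an anchoring κ) is the special case `b := θ.cβ • beta0OfJs F κ`, `L := θ.cβ · lim`.

HONEST SCOPE (A6, director-ym №189).  Elementary real analysis over hypothesis SHAPES; every letter (N17, corner limits, their limit's sign, (C)) is a HYPOTHESIS inhabited at no θ here
(instance 0∕1); §1–§2 quantify over `θ : Stage13HParams F 2` with `hP : θ.Provisos₁₃SepCoPH F 2` — inhabited iff K0⁷ (stmt-QuantumFields-20541).  NOTHING of Bałaban is asserted or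
instantiated: NE4 NOT IN PRINT ([Balaban1987RG1] p. 264) and NOT proved; the existence of corner limits, the AF SIGN, (C) NOT proved; NOT a proof of `stub_cornerDriftPos13`,
`stub_runChainCornerSlope13`, `stub_rates13H` or any stub; N17 NOT discharged (DEPENDENT∕DERIVED row); K2⁷ ∕ K3⁷ OPEN; counts UNMOVED (typed 28∕28 · discharged 5∕27 · A 5∕28).  One finite
four-torus programme at fixed `ε = L^{−K}`, Bałaban AS PRINTED; the YM mass gap (Clay) is NOT proved by any of this — R4 closes the conditional finite-𝕋⁴ rung `BalabanLadder.UV` only; nothing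
continuum ∕ ℝ⁴ ∕ OS.  No `instance`, no `notation`, no `axiom`.  [I] = [Balaban1987RG1] T. Bałaban, CMP **109** (1987): Thm 2 p. 259, (1.3) p. 260, (1.20)–(1.22) p. 264, Thm 3 p. 264,
(2.12)–(2.14) p. 268.
-/

noncomputable section

namespace Summit.QuantumFields.YangMills.BalabanUVNodes.N17CornerLimitSign

open Literature.MathematicalPhysics.QuantumFieldTheory.Balaban1983to89
open Literature.MathematicalPhysics.QuantumFieldTheory.Balaban1983to89.FlowStep
open Literature.MathematicalPhysics.QuantumFieldTheory.Balaban1983to89.DagBinding (EndpointExistence)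
open Literature.MathematicalPhysics.QuantumFieldTheory.Balaban1983to89.T4Continuum (T4Family)
open Literature.MathematicalPhysics.QuantumFieldTheory.Balaban1983to89.Beta.Drift (OneLoopDrift)
open Summit.QuantumFields.YangMills.Theorems.BalabanUVNodesK2NamedJetsRemAt (ScaleAnchor)
open Summit.QuantumFields.YangMills.Theorems.BalabanUVNodesK2NamedJetsRunRemAt (SurvCont)
open Summit.QuantumFields.YangMills.Theorems.BalabanUVNodesK2V6Defs (Window13)
open Summit.QuantumFields.YangMills.BalabanUVNodes.N17RunRemAtOfShiftAnchor (conv_of_scaleShiftRate_scaleAnchor scaleShiftRate_of_n17At_window)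
open Summit.QuantumFields.YangMills.BalabanUVNodes.N17D1OfNamedLimit (oneLoopDrift_of_abs_sub_le_geometric slope_eq_lim_of_oneLoopDrift)
open Summit.QuantumFields.YangMills.BalabanUVNodes.N17RunWindowShiftCornerDrift (endpointExistence_of_cornerDriftPos_n17At_survContAt)
open Finset Filter Topology

/-! ## §1 At NODE 00's Stage-13 record (`N = 2`): GIVEN node N17 and corner limits, «positive-slope drift» ⟺ «positive limit» -/

section Record

open YMDAG.UVSplit (U3Carriers N17At)

variable (F : T4Family) (θ : Node00.Stage13HParams F 2) (hP : θ.Provisos₁₃SepCoPH F 2)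

/-- **GIVEN N17 + CORNER LIMITS `b`, the corner numbers CONVERGE and DRIFT WITH THEIR LIMIT AS SLOPE**: `∃ L A, Tendsto b atTop (𝓝 L) ∧ OneLoopDrift L A b` (FILE 1's geometric convergence
`|b_k − L| ≤ (c∕(1−u.ρ))·u.ρ^k` + FILE 3's «geometric ⟹ drift»).  CONDITIONAL on N17 and the anchor. [cite: Balaban1987RG1, (1.20)-(1.22) p.264 and (2.12)-(2.14) p.268] -/
theorem exists_lim_drift_of_n17At_scaleAnchor (hθ : θ.Admissible F 2) {u : U3Carriers} (hγu : u.γ = θ.γ) (hρ0 : 0 ≤ u.ρ) (hρ1 : u.ρ < 1)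
    (h17 : N17At (Node00.datumOfRecord₁₃SepCoPH F 2 θ hP) u) {b : ℕ → ℝ} (hA : ScaleAnchor (Node00.datumOfRecord₁₃SepCoPH F 2 θ hP).βfun b) :
    ∃ L A : ℝ, Tendsto b atTop (𝓝 L) ∧ OneLoopDrift L A b := by
  have hγ : 0 < θ.γ := hθ.toStage12.toStage9.gamma_pos
  obtain ⟨L, hT, hbd⟩ := conv_of_scaleShiftRate_scaleAnchor hγ hρ1 hA (scaleShiftRate_of_n17At_window F θ hP hγu h17)
  exact ⟨L, _, hT, oneLoopDrift_of_abs_sub_le_geometric hρ0 hρ1 hbd⟩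

/-- ★★ **GIVEN N17 + CORNER LIMITS `b`: «`b` DRIFTS WITH SOME POSITIVE SLOPE» (2ᶜᴰ's conclusion at the tuple) ⟺ «`b` TENDS TO SOME POSITIVE LIMIT»** (→: a drift slope of a convergent sequence
is its limit, FILE 3's Cesàro lemma; ←: the previous theorem + uniqueness of limits).  So the drift ∕ summability half of v7's 2ᶜᴰ is node N17's; what remains is the SIGN of one limit.
CONDITIONAL on N17 and the anchor. [cite: Balaban1987RG1, (1.3) p.260, (1.20)-(1.22) p.264 and (2.12)-(2.14) p.268] -/
theorem cornerDriftPos_iff_limPos_of_n17At_scaleAnchor (hθ : θ.Admissible F 2) {u : U3Carriers} (hγu : u.γ = θ.γ) (hρ0 : 0 ≤ u.ρ) (hρ1 : u.ρ < 1)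
    (h17 : N17At (Node00.datumOfRecord₁₃SepCoPH F 2 θ hP) u) {b : ℕ → ℝ} (hA : ScaleAnchor (Node00.datumOfRecord₁₃SepCoPH F 2 θ hP).βfun b) :
    (∃ s A : ℝ, 0 < s ∧ OneLoopDrift s A b) ↔ ∃ L : ℝ, Tendsto b atTop (𝓝 L) ∧ 0 < L := by
  obtain ⟨L, A, hT, hd⟩ := exists_lim_drift_of_n17At_scaleAnchor F θ hP hθ hγu hρ0 hρ1 h17 hA
  constructor
  · rintro ⟨s, A', hs, hd'⟩
    exact ⟨L, hT, (slope_eq_lim_of_oneLoopDrift hd' hT) ▸ hs⟩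
  · rintro ⟨L', hT', hL'⟩
    exact ⟨L, A, (tendsto_nhds_unique hT hT') ▸ hL', hd⟩

/-- … and an EVENTUAL POSITIVE FLOOR suffices for the sign: GIVEN N17 + corner limits `b`, `(∃ δ > 0, ∀ᶠ k, δ ≤ b k) → ∃ s A, 0 < s ∧ OneLoopDrift s A b` (the limit exists by N17 and is `≥ δ`).
CONDITIONAL. [cite: Balaban1987RG1, (1.3) p.260 and (1.20)-(1.22) p.264] -/
theorem cornerDriftPos_of_n17At_scaleAnchor_eventuallyFloor (hθ : θ.Admissible F 2) {u : U3Carriers} (hγu : u.γ = θ.γ) (hρ0 : 0 ≤ u.ρ) (hρ1 : u.ρ < 1)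
    (h17 : N17At (Node00.datumOfRecord₁₃SepCoPH F 2 θ hP) u) {b : ℕ → ℝ} (hA : ScaleAnchor (Node00.datumOfRecord₁₃SepCoPH F 2 θ hP).βfun b)
    {δ : ℝ} (hδ : 0 < δ) (hfl : ∀ᶠ k in atTop, δ ≤ b k) : ∃ s A : ℝ, 0 < s ∧ OneLoopDrift s A b := by
  obtain ⟨L, A, hT, hd⟩ := exists_lim_drift_of_n17At_scaleAnchor F θ hP hθ hγu hρ0 hρ1 h17 hA
  exact ⟨L, A, lt_of_lt_of_le hδ (ge_of_tendsto hT hfl), hd⟩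

/-- ★★ **THE END AT ONE RECORD FROM NODE N17 + CORNER LIMITS WITH A POSITIVE LIMIT + ONE-LEVEL (C)** (this §1 + FILE 6's `endpointExistence_of_cornerDriftPos_n17At_survContAt`): κ-free, v₀-free, no
named jets, no value of the limit.  CONDITIONAL on every displayed letter. [cite: Balaban1987RG1, Thm 2 p.259 (first sentence), (1.3) p.260, (1.20)-(1.22) p.264, Thm 3 p.264 and (2.12)-(2.14) p.268] -/
theorem endpointExistence_of_n17At_scaleAnchor_limPos_survContAt (hθ : θ.Admissible F 2) {u : U3Carriers} (hγu : u.γ = θ.γ) (hρ0 : 0 ≤ u.ρ) (hρ1 : u.ρ < 1)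
    (h17 : N17At (Node00.datumOfRecord₁₃SepCoPH F 2 θ hP) u) {b : ℕ → ℝ} (hA : ScaleAnchor (Node00.datumOfRecord₁₃SepCoPH F 2 θ hP).βfun b)
    {L : ℝ} (hT : Tendsto b atTop (𝓝 L)) (hL : 0 < L) {γ₀ : ℝ} (hγ₀ : 0 < γ₀) (hsc : SurvCont (Node00.datumOfRecord₁₃SepCoPH F 2 θ hP).βfun γ₀) :
    EndpointExistence (Node00.datumOfRecord₁₃SepCoPH F 2 θ hP).C.toB12 := by
  obtain ⟨s, A, hs, hd⟩ := (cornerDriftPos_iff_limPos_of_n17At_scaleAnchor F θ hP hθ hγu hρ0 hρ1 h17 hA).2 ⟨L, hT, hL⟩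
  exact endpointExistence_of_cornerDriftPos_n17At_survContAt F θ hP hθ hγu hρ0 hρ1 h17 hA hs hd hγ₀ hsc

end Record

/-! ## §2 Text level (K2⁷ v7's full prefix, `Window13` = DEF-1's tree def): GIVEN the `N17AtRecord13` text, the REGISTERED 2ᶜᴰ text ⟺ the positive-corner-limit text; the crux from N17 + sign + (C) -/

section Texts

/-- ★★★ **2ᶜᴰ's REGISTERED TEXT `CornerDriftPos` (v7 795c9e8285fed415; conclusion VERBATIM) FROM THE END-free `N17AtRecord13` TEXT + (CLP13) «at every prefixed tuple the record's β has in-box corner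
limits `b` tending to SOME POSITIVE limit»** — a SUPPLIER ROAD of `stub_cornerDriftPos13` through node N17 (the sign letter stays a hypothesis; NOT a proof of the stub).
[cite: Balaban1987RG1, (1.3) p.260, (1.20)-(1.22) p.264 and (2.12)-(2.14) p.268] -/
theorem cornerDriftPos13_of_n17AtRecord13_cornerLimitPos13
    (h17 : ∀ (F : T4Family) (θ : Node00.Stage13HParams F 2) (hP : θ.Provisos₁₃SepCoPH F 2), (θ.ZhUnity F 2 ∧ θ.SlotsNondegenerate₁₃ F 2) → θ.Admissible F 2 →
      B16.EndStatementBPrinted (Node00.datumOfRecord₁₃SepCoPH F 2 θ hP).C → Window13 F θ hP →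
      ∃ u : YMDAG.UVSplit.U3Carriers, u.γ = θ.γ ∧ 0 ≤ u.ρ ∧ u.ρ < 1 ∧ YMDAG.UVSplit.N17At (Node00.datumOfRecord₁₃SepCoPH F 2 θ hP) u)
    (hCL : ∀ (F : T4Family) (θ : Node00.Stage13HParams F 2) (hP : θ.Provisos₁₃SepCoPH F 2), (θ.ZhUnity F 2 ∧ θ.SlotsNondegenerate₁₃ F 2) → θ.Admissible F 2 →
      B16.EndStatementBPrinted (Node00.datumOfRecord₁₃SepCoPH F 2 θ hP).C → Window13 F θ hP →
      ∃ (b : ℕ → ℝ) (L : ℝ), ScaleAnchor (Node00.datumOfRecord₁₃SepCoPH F 2 θ hP).βfun b ∧ Tendsto b atTop (𝓝 L) ∧ 0 < L) :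
    ∀ (F : T4Family) (θ : Node00.Stage13HParams F 2) (hP : θ.Provisos₁₃SepCoPH F 2), (θ.ZhUnity F 2 ∧ θ.SlotsNondegenerate₁₃ F 2) → θ.Admissible F 2 →
      B16.EndStatementBPrinted (Node00.datumOfRecord₁₃SepCoPH F 2 θ hP).C → Window13 F θ hP →
      ∃ (b : ℕ → ℝ) (s A : ℝ), ScaleAnchor (Node00.datumOfRecord₁₃SepCoPH F 2 θ hP).βfun b ∧ 0 < s ∧ OneLoopDrift s A b := by
  intro F θ hP hU hθ hB hwin
  obtain ⟨u, hγu, hρ0, hρ1, hN⟩ := h17 F θ hP hU hθ hB hwin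
  obtain ⟨b, L, hA, hT, hL⟩ := hCL F θ hP hU hθ hB hwin
  obtain ⟨s, A, hs, hd⟩ := (cornerDriftPos_iff_limPos_of_n17At_scaleAnchor F θ hP hθ hγu hρ0 hρ1 hN hA).2 ⟨L, hT, hL⟩
  exact ⟨b, s, A, hA, hs, hd⟩

/-- **THE CONVERSE: 2ᶜᴰ's text + the `N17AtRecord13` text ⟹ (CLP13)** — so GIVEN node N17 the registered (D1)-side stub and the positive-corner-limit text are EQUIVALENT obligations. [folklore] -/
theorem cornerLimitPos13_of_cornerDriftPos13_n17AtRecord13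
    (hCD : ∀ (F : T4Family) (θ : Node00.Stage13HParams F 2) (hP : θ.Provisos₁₃SepCoPH F 2), (θ.ZhUnity F 2 ∧ θ.SlotsNondegenerate₁₃ F 2) → θ.Admissible F 2 →
      B16.EndStatementBPrinted (Node00.datumOfRecord₁₃SepCoPH F 2 θ hP).C → Window13 F θ hP →
      ∃ (b : ℕ → ℝ) (s A : ℝ), ScaleAnchor (Node00.datumOfRecord₁₃SepCoPH F 2 θ hP).βfun b ∧ 0 < s ∧ OneLoopDrift s A b)
    (h17 : ∀ (F : T4Family) (θ : Node00.Stage13HParams F 2) (hP : θ.Provisos₁₃SepCoPH F 2), (θ.ZhUnity F 2 ∧ θ.SlotsNondegenerate₁₃ F 2) → θ.Admissible F 2 →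
      B16.EndStatementBPrinted (Node00.datumOfRecord₁₃SepCoPH F 2 θ hP).C → Window13 F θ hP →
      ∃ u : YMDAG.UVSplit.U3Carriers, u.γ = θ.γ ∧ 0 ≤ u.ρ ∧ u.ρ < 1 ∧ YMDAG.UVSplit.N17At (Node00.datumOfRecord₁₃SepCoPH F 2 θ hP) u) :
    ∀ (F : T4Family) (θ : Node00.Stage13HParams F 2) (hP : θ.Provisos₁₃SepCoPH F 2), (θ.ZhUnity F 2 ∧ θ.SlotsNondegenerate₁₃ F 2) → θ.Admissible F 2 →
      B16.EndStatementBPrinted (Node00.datumOfRecord₁₃SepCoPH F 2 θ hP).C → Window13 F θ hP →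
      ∃ (b : ℕ → ℝ) (L : ℝ), ScaleAnchor (Node00.datumOfRecord₁₃SepCoPH F 2 θ hP).βfun b ∧ Tendsto b atTop (𝓝 L) ∧ 0 < L := by
  intro F θ hP hU hθ hB hwin
  obtain ⟨u, hγu, hρ0, hρ1, hN⟩ := h17 F θ hP hU hθ hB hwin
  obtain ⟨b, s, A, hA, hs, hd⟩ := hCD F θ hP hU hθ hB hwin
  obtain ⟨L, hT, hL⟩ := (cornerDriftPos_iff_limPos_of_n17At_scaleAnchor F θ hP hθ hγu hρ0 hρ1 hN hA).1 ⟨s, A, hs, hd⟩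
  exact ⟨b, L, hA, hT, hL⟩

/-- ★★★ **THE K2⁷ CRUX DECL BY NAME (`Summit.QuantumFields.YangMills.Theses.BalabanUVNodes.EndpointGivenBR13SepCoPH`) FROM {`N17AtRecord13`, (CLP13) «in-box corner limits with a POSITIVE limit»,
«∃ γ₀ > 0, SurvCont»}** — MODULO NODE N17 and one-level (C), K2⁷ v7 = existence of the corner limits + the SIGN of their limit (κ-free, v₀-free, no value).  CONDITIONAL on the three displayed texts;
K2⁷ NOT closed; NOT a proof of any stub; nothing of Bałaban asserted. [cite: Balaban1987RG1, Thm 2 p.259 (first sentence), (1.3) p.260, Thm 3 p.264, (1.20)-(1.22) p.264 and (2.12)-(2.14) p.268] -/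
theorem EndpointGivenBR13SepCoPH_of_n17AtRecord13_cornerLimitPos13_surv13
    (h17 : ∀ (F : T4Family) (θ : Node00.Stage13HParams F 2) (hP : θ.Provisos₁₃SepCoPH F 2), (θ.ZhUnity F 2 ∧ θ.SlotsNondegenerate₁₃ F 2) → θ.Admissible F 2 →
      B16.EndStatementBPrinted (Node00.datumOfRecord₁₃SepCoPH F 2 θ hP).C → Window13 F θ hP →
      ∃ u : YMDAG.UVSplit.U3Carriers, u.γ = θ.γ ∧ 0 ≤ u.ρ ∧ u.ρ < 1 ∧ YMDAG.UVSplit.N17At (Node00.datumOfRecord₁₃SepCoPH F 2 θ hP) u)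
    (hCL : ∀ (F : T4Family) (θ : Node00.Stage13HParams F 2) (hP : θ.Provisos₁₃SepCoPH F 2), (θ.ZhUnity F 2 ∧ θ.SlotsNondegenerate₁₃ F 2) → θ.Admissible F 2 →
      B16.EndStatementBPrinted (Node00.datumOfRecord₁₃SepCoPH F 2 θ hP).C → Window13 F θ hP →
      ∃ (b : ℕ → ℝ) (L : ℝ), ScaleAnchor (Node00.datumOfRecord₁₃SepCoPH F 2 θ hP).βfun b ∧ Tendsto b atTop (𝓝 L) ∧ 0 < L)
    (hS : ∀ (F : T4Family) (θ : Node00.Stage13HParams F 2) (hP : θ.Provisos₁₃SepCoPH F 2), (θ.ZhUnity F 2 ∧ θ.SlotsNondegenerate₁₃ F 2) → θ.Admissible F 2 →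
      B16.EndStatementBPrinted (Node00.datumOfRecord₁₃SepCoPH F 2 θ hP).C → Window13 F θ hP →
      ∃ γ₀ : ℝ, 0 < γ₀ ∧ SurvCont (Node00.datumOfRecord₁₃SepCoPH F 2 θ hP).βfun γ₀) :
    Summit.QuantumFields.YangMills.Theses.BalabanUVNodes.EndpointGivenBR13SepCoPH := by
  intro F θ hP hU hθ hB hwin
  obtain ⟨u, hγu, hρ0, hρ1, hN⟩ := h17 F θ hP hU hθ hB hwin
  obtain ⟨b, L, hA, hT, hL⟩ := hCL F θ hP hU hθ hB hwin
  obtain ⟨γ₀, hγ₀, hsc⟩ := hS F θ hP hU hθ hB hwin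
  exact endpointExistence_of_n17At_scaleAnchor_limPos_survContAt F θ hP hθ hγu hρ0 hρ1 hN hA hT hL hγ₀ hsc

end Texts

end Summit.QuantumFields.YangMills.BalabanUVNodes.N17CornerLimitSign

end
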